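import Literature.Algebra.Homology.DiscreteRepVanishingAlongQuotients
import Literature.NumberTheory.GaloisRepresentations.RestrictedRamificationInflationTwo
import Literature.NumberTheory.GaloisRepresentations.RestrictedRamificationKummer
import Literature.NumberTheory.EllipticCurves.PeriodIndexSupport
import Literature.GroupTheory.ProfiniteSubquotients
import HarnessLib

/-!
# `H^n(U, μ_p) = 0` over `K_S` for EVERY `S ⊇ S_p` from the FINITE `S ⊇ S_p`
# (`K_S = ⋃_{S′ ⊆ S finite} K_{S′}`, Neukirch–Schmidt–Wingberg VIII §3; Serre I §2.2 Prop. 8)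

Topic `NumberTheory/GaloisCohomology`; namespace `Literature.NumberTheory.GaloisCohomology`.
THEOREMS ONLY (no definition, no named fact, no instance, no `sorry`; D-0026).

Lane «PT3-TC» of cell `bsd-eis` (crux `GoodLatticeBDPValue`, stmt-BirchSwinnertonDyer-19032) reduces
Harari Cor. 17.14 / Thm. 17.13 (a) (at a totally complex `K`) to the single arithmetic statement
**(H3μ)_K** (`RestrictedRamificationCdTwoOfH3Mu.lean`): for every set `S` of finite places containing the
places above `p` (`p ≠ 2` if `K` has a real place), every `G_{K,S}`-module structure `ρ₀` on `μ_p`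
lifting the Galois action and every OPEN `U ≤ G_{K,S}` fixing `μ_p`, `H³(U, μ_p) = 0`.  The idèle-class
bricks of the lane prove (H3μ) for FINITE `S` (the `S`-idèle class formation wants `S` finite), while
the named facts quantify over arbitrary `S`.  This file closes the gap, in the exact token shape of the
hypothesis of `groupCdLE_two_galoisGroupUnramifiedOutside_of_forall_H3_mu` (any degree `n`):

> **`forall_subsingleton_continuousCohomology_mu_of_finite`**: (H3μ)_K for the FINITE `S ⊇ S_p`
> ⟹ (H3μ)_K for every `S ⊇ S_p`.

PROOF.  `K_S = ⋃ K_{S′}` over the finite `S_p ⊆ S′ ⊆ S`: for `U ≤ G_{K,S} = Γ_K⧸N_S` open and an open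
normal `V ⊴ U`, the normal core `Ṽ₀ ⊴ Γ_K` of the preimage of `V` is OPEN and contains `N_S`, so by
the finiteness of ramification (`eventually_forall_inertia_le`: all inertia groups above all but
finitely many `v` lie in `Ṽ₀`) there is a finite `S′`, `S_p ⊆ S′ ⊆ S`, with `N_{S′} ≤ Ṽ₀`
(`ramificationSubgroup_le_ker`).  Hence the kernel of `θ_{S′} : U ↠ U′ := image of U in G_{K,S′}`
(induced by `Γ_K⧸N_S ↠ Γ_K⧸N_{S′}`) lies in `V`: the surjections `θ_{S′}` are COFINAL among the open
normal subgroups of the profinite group `U`, `U′` is open and fixes `μ_p` (for a lift `ρ₀′` at level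
`S′`, `exists_continuousRep_galoisGroupAbove_mu`), so `Hⁿ(U′, μ_p) = 0` by hypothesis, and
`Hⁿ(U, μ_p) = 0` follows from the descent theorem for trivial coefficients
`DiscreteRep.subsingleton_continuousCohomology_trivial_of_cofinal_surjections` (Serre I §2.2 Prop. 8).

* §1 plumbing for the projection `G_{K,S} ↠ G_{K,S′}` (`S′ ⊆ S`): `quotientMapOfSubset` lemmas stated
  on `QuotientGroup.map _ _ (MonoidHom.id _) (ramificationSubgroup_mono h)` (no definition);
* §2 `exists_finite_ramificationSubgroup_le` — `K_S = ⋃ K_{S′}`: an open subgroup of `Γ_K` containing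
  `N_S` contains `N_{S′}` for a finite `S_p ⊆ S′ ⊆ S`;
* §3 **`forall_subsingleton_continuousCohomology_mu_of_finite`**.

HONEST FRAMING: plumbing between the finite-`S` and arbitrary-`S` forms of one hypothesis; no case of
(H3μ), of Harari 17.13 (a) / 17.14, or of BSD is proved here.

## References
* J. Neukirch, A. Schmidt, K. Wingberg, *Cohomology of Number Fields*, 2nd ed. (2008), VIII §3
  (`k_S`, `G_S = G(k_S/k)`), (8.3.18) and its proof. [NeukirchSchmidtWingberg2008]
* J.-P. Serre, *Galois Cohomology* (1997), I §2.2 Proposition 8 and Corollary 1. [SerreGaloisCohomology1997]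
* J. Neukirch, *Algebraic Number Theory* (1999), Ch. III §2 Thm. (2.6) (only finitely many primes
  ramify). [NeukirchANT1999]
-/

noncomputable section

open CategoryTheory Function NumberField Field IsDedekindDomain Topology
open scoped NumberField

namespace Literature.NumberTheory.GaloisCohomology

open Literature.NumberTheory.GaloisRepresentations
open Literature.NumberTheory.GaloisRepresentations.DiscreteGaloisModule (mu MuCarrier mu_apply_apply)
open Literature.NumberTheory.IwasawaTheory.Greenberg2006 (galoisGroupAbove)
open Literature.Algebra.Homology.DiscreteRep
open _root_.TopRep _root_.ContRepresentation _root_.ContinuousCohomology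

variable {K : Type} [Field K] [NumberField K]

/-! ### §1. The projection `G_{K,S} ↠ G_{K,S′}` for `S′ ⊆ S` -/

omit [NumberField K] in
/-- The projection `G_{K,S} = Γ_K⧸N_S ↠ Γ_K⧸N_{S′} = G_{K,S′}` (`S′ ⊆ S`, so `N_S ≤ N_{S′}`) on classes:
`σ N_S ↦ σ N_{S′}`. [cite: NeukirchSchmidtWingberg2008, VIII §3] -/
theorem quotientMapOfSubset_mk {S S' : Set (HeightOneSpectrum (𝓞 K))} (h : S' ⊆ S)
    (σ : absoluteGaloisGroup K) :
    QuotientGroup.map (ramificationSubgroup K S) (ramificationSubgroup K S') (MonoidHom.id _)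
        (ramificationSubgroup_mono h) (toUnramifiedQuot K S σ) = toUnramifiedQuot K S' σ :=
  rfl

omit [NumberField K] in
/-- The projection `G_{K,S} ↠ G_{K,S′}` is continuous. [cite: NeukirchSchmidtWingberg2008, VIII §3] -/
theorem continuous_quotientMapOfSubset {S S' : Set (HeightOneSpectrum (𝓞 K))} (h : S' ⊆ S) :
    Continuous (QuotientGroup.map (ramificationSubgroup K S) (ramificationSubgroup K S') (MonoidHom.id _)
      (ramificationSubgroup_mono h)) := by
  rw [(QuotientGroup.isQuotientMap_mk (ramificationSubgroup K S)).continuous_iff]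
  exact continuous_toUnramifiedQuot K S'

omit [NumberField K] in
/-- The projection `G_{K,S} ↠ G_{K,S′}` is onto. [cite: NeukirchSchmidtWingberg2008, VIII §3] -/
theorem surjective_quotientMapOfSubset {S S' : Set (HeightOneSpectrum (𝓞 K))} (h : S' ⊆ S) :
    Function.Surjective (QuotientGroup.map (ramificationSubgroup K S) (ramificationSubgroup K S')
      (MonoidHom.id _) (ramificationSubgroup_mono h)) := fun g => by
  obtain ⟨σ, rfl⟩ := toUnramifiedQuot_surjective K S' g
  exact ⟨toUnramifiedQuot K S σ, rfl⟩

/-! ### §2. `K_S = ⋃_{S′ finite} K_{S′}`: open subgroups above `N_S` lie above some `N_{S′}` -/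

/-- Only finitely many finite places of a number field lie above the rational prime `p`. [folklore] -/
private theorem finite_setOf_natCast_mem_asIdeal (p : ℕ) [Fact p.Prime] :
    {v : HeightOneSpectrum (𝓞 K) | ((p : ℕ) : 𝓞 K) ∈ v.asIdeal}.Finite := by
  have hI : (Ideal.span {((p : ℕ) : 𝓞 K)} : Ideal (𝓞 K)) ≠ 0 := by
    rw [Ne, Ideal.zero_eq_bot, Ideal.span_singleton_eq_bot]
    exact_mod_cast (Fact.out : p.Prime).ne_zero
  refine (Ideal.finite_factors hI).subset fun v hv => ?_
  exact (Ideal.dvd_span_singleton).2 hv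

/-- **`K_S = ⋃ K_{S′}` over the finite `S_p ⊆ S′ ⊆ S`** (Neukirch–Schmidt–Wingberg VIII §3: a finite
extension inside `k_S` is ramified at only finitely many places): an OPEN subgroup `H ≤ Γ_K` containing
`N_S` contains `N_{S′}` for some FINITE `S′ ⊆ S` containing every place above `p` (any prime `p` with
`S ⊇ S_p`).  Proof: the normal core `H₀` of `H` is open and contains `N_S`; all inertia groups above all
but finitely many places lie in `H₀` (`eventually_forall_inertia_le`); take `S′ = S ∩ (T ∪ S_p)` with `T`
the exceptional set, and `N_{S′} ≤ H₀` by `ramificationSubgroup_le_ker`.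
[cite: NeukirchSchmidtWingberg2008, VIII §3] [cite: NeukirchANT1999, Ch. III §2 Thm. (2.6)] -/
theorem exists_finite_ramificationSubgroup_le (S : Set (HeightOneSpectrum (𝓞 K))) (p : ℕ) [Fact p.Prime]
    (hSp : ∀ v : HeightOneSpectrum (𝓞 K), ((p : ℕ) : 𝓞 K) ∈ v.asIdeal → v ∈ S)
    (H : Subgroup (absoluteGaloisGroup K)) (hH : IsOpen (H : Set (absoluteGaloisGroup K)))
    (hNS : ramificationSubgroup K S ≤ H) :
    ∃ S' : Set (HeightOneSpectrum (𝓞 K)), S' ⊆ S ∧ S'.Finite ∧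
      (∀ v : HeightOneSpectrum (𝓞 K), ((p : ℕ) : 𝓞 K) ∈ v.asIdeal → v ∈ S') ∧
      ramificationSubgroup K S' ≤ H := by
  classical
  -- the normal core `H₀` of `H`: open, normal, `N_S ≤ H₀ ≤ H`
  haveI : Finite (absoluteGaloisGroup K ⧸ H) := Subgroup.quotient_finite_of_isOpen H hH
  haveI : H.FiniteIndex := Subgroup.finiteIndex_of_finite_quotient
  have hH₀o : IsOpen (H.normalCore : Set (absoluteGaloisGroup K)) :=
    Subgroup.isOpen_of_isClosed_of_finiteIndex _ (H.normalCore_isClosed (H.isClosed_of_isOpen hH))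
  have hNS₀ : ramificationSubgroup K S ≤ H.normalCore := Subgroup.normal_le_normalCore.2 hNS
  -- finiteness of ramification
  have hev := Literature.NumberTheory.EllipticCurves.eventually_forall_inertia_le (F := K) H.normalCore hH₀o
  rw [Filter.eventually_cofinite] at hev
  set T : Set (HeightOneSpectrum (𝓞 K)) :=
    {v | ¬ ∀ 𝔓 ∈ v.primesAbove, 𝔓.inertia (absoluteGaloisGroup K) ≤ H.normalCore} with hT
  refine ⟨S ∩ (T ∪ {v | ((p : ℕ) : 𝓞 K) ∈ v.asIdeal}), Set.inter_subset_left,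
    (hev.union (finite_setOf_natCast_mem_asIdeal p)).subset Set.inter_subset_right,
    fun v hv => ⟨hSp v hv, Or.inr hv⟩, ?_⟩
  -- `N_{S′} ≤ H₀ ≤ H`
  refine le_trans ?_ H.normalCore_le
  have hker : (QuotientGroup.mk' H.normalCore).ker = H.normalCore := QuotientGroup.ker_mk' _
  rw [← hker]
  refine ramificationSubgroup_le_ker _ (by rw [hker]; exact hH₀o) fun v hv 𝔓 h𝔓 σ hσ => ?_
  rw [← MonoidHom.mem_ker, hker]
  by_cases hvT : v ∈ T
  · -- then `v ∉ S`, so `I_𝔓 ≤ N_S ≤ H₀`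
    have hvS : v ∉ S := fun hvS => hv ⟨hvS, Or.inl hvT⟩
    exact hNS₀ (inertia_le_ramificationSubgroup hvS h𝔓 hσ)
  · exact not_not.1 hvT 𝔓 h𝔓 hσ

/-! ### §3. (H3μ) for every `S ⊇ S_p` from the finite `S ⊇ S_p` -/

/-- **(H3μ)_K for EVERY `S ⊇ S_p` FROM the FINITE `S ⊇ S_p`** (any degree `n`; the hypothesis of
`groupCdLE_two_galoisGroupUnramifiedOutside_of_forall_H3_mu` is the case `n = 3`): if for every FINITE
set `S′ ∋ (v ∣ p)` (`p ≠ 2` when `K` has a real place), every `G_{K,S′}`-module structure `ρ₀′` on `μ_p`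
lifting the Galois action and every open `U′ ≤ G_{K,S′}` fixing `μ_p` one has `Hⁿ(U′, μ_p) = 0`, then
the same holds for every set `S ∋ (v ∣ p)`.  (`K_S = ⋃ K_{S′}`: the surjections
`U ↠ U N_{S′}/N_{S′} ≤ G_{K,S′}`, `S′ ⊆ S` finite, are cofinal among the open normal subgroups of `U` by
`exists_finite_ramificationSubgroup_le`, and Serre I §2.2 Prop. 8 in the form
`DiscreteRep.subsingleton_continuousCohomology_trivial_of_cofinal_surjections` descends the vanishing.)
[cite: NeukirchSchmidtWingberg2008, VIII §3; proof of (8.3.18)]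
[cite: SerreGaloisCohomology1997, I §2.2 Proposition 8 and Corollary 1] -/
theorem forall_subsingleton_continuousCohomology_mu_of_finite (n : ℕ)
    (h : ∀ (S : Set (HeightOneSpectrum (𝓞 K))) (p : ℕ) [Fact p.Prime], S.Finite →
      (∀ v : HeightOneSpectrum (𝓞 K), ((p : ℕ) : 𝓞 K) ∈ v.asIdeal → v ∈ S) →
      ((∃ w : InfinitePlace K, w.IsReal) → p ≠ 2) →
      ∀ (ρ₀ : ContinuousRep (GaloisGroupUnramifiedOutside K S) ℤ (MuCarrier K p)),
        (∀ (σ : absoluteGaloisGroup K) (v : MuCarrier K p),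
          ρ₀ (toUnramifiedQuot K S σ) v = mu K p σ v) →
      ∀ (U : Subgroup (GaloisGroupUnramifiedOutside K S)),
        IsOpen (U : Set (GaloisGroupUnramifiedOutside K S)) →
        (∀ g ∈ U, ∀ v : MuCarrier K p, ρ₀ g v = v) →
          Subsingleton (continuousCohomology n (ρ₀.restrict (subgroupIncl U)).toTopRep))
    (S : Set (HeightOneSpectrum (𝓞 K))) (p : ℕ) [Fact p.Prime]
    (hSp : ∀ v : HeightOneSpectrum (𝓞 K), ((p : ℕ) : 𝓞 K) ∈ v.asIdeal → v ∈ S)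
    (hreal : (∃ w : InfinitePlace K, w.IsReal) → p ≠ 2)
    (ρ₀ : ContinuousRep (GaloisGroupUnramifiedOutside K S) ℤ (MuCarrier K p))
    (hρ₀ : ∀ (σ : absoluteGaloisGroup K) (v : MuCarrier K p), ρ₀ (toUnramifiedQuot K S σ) v = mu K p σ v)
    (U : Subgroup (GaloisGroupUnramifiedOutside K S)) (hU : IsOpen (U : Set (GaloisGroupUnramifiedOutside K S)))
    (hfix : ∀ g ∈ U, ∀ v : MuCarrier K p, ρ₀ g v = v) :
    Subsingleton (continuousCohomology n (ρ₀.restrict (subgroupIncl U)).toTopRep) := by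
  classical
  haveI hp : Fact p.Prime := inferInstance
  haveI : NeZero p := ⟨hp.out.ne_zero⟩
  haveI : TotallyDisconnectedSpace (GaloisGroupUnramifiedOutside K S) :=
    Literature.GroupTheory.ProfiniteSubquotients.totallyDisconnectedSpace_quotient
      (ramificationSubgroup K S) (ramificationSubgroup_isClosed K S)
  haveI : CompactSpace U := isCompact_iff_compactSpace.mp (Subgroup.isClosed_of_isOpen U hU).isCompact
  -- the index set: finite `S′`, `S_p ⊆ S′ ⊆ S`
  let ι : Type := {S' : Set (HeightOneSpectrum (𝓞 K)) //
    S' ⊆ S ∧ S'.Finite ∧ ∀ v : HeightOneSpectrum (𝓞 K), ((p : ℕ) : 𝓞 K) ∈ v.asIdeal → v ∈ S'}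
  -- the projections `π_{S′} : G_{K,S} ↠ G_{K,S′}` and `θ_{S′} : U ↠ U′ := π_{S′}(U)`
  let π : ∀ i : ι, GaloisGroupUnramifiedOutside K S →* GaloisGroupUnramifiedOutside K i.1 := fun i =>
    QuotientGroup.map (ramificationSubgroup K S) (ramificationSubgroup K i.1) (MonoidHom.id _)
      (ramificationSubgroup_mono i.2.1)
  have hπc : ∀ i, Continuous (π i) := fun i => continuous_quotientMapOfSubset i.2.1
  have hπs : ∀ i, Function.Surjective (π i) := fun i => surjective_quotientMapOfSubset i.2.1
  haveI : ∀ i : ι, TotallyDisconnectedSpace (GaloisGroupUnramifiedOutside K i.1) := fun i =>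
    Literature.GroupTheory.ProfiniteSubquotients.totallyDisconnectedSpace_quotient
      (ramificationSubgroup K i.1) (ramificationSubgroup_isClosed K i.1)
  let U' : ∀ i : ι, Subgroup (GaloisGroupUnramifiedOutside K i.1) := fun i => U.map (π i)
  have hU'o : ∀ i, IsOpen (U' i : Set (GaloisGroupUnramifiedOutside K i.1)) := fun i =>
    isOpen_coe_map_of_surjective (π i) (hπc i) (hπs i) U hU
  haveI : ∀ i, CompactSpace (U' i) := fun i =>
    isCompact_iff_compactSpace.mp (Subgroup.isClosed_of_isOpen (U' i) (hU'o i)).isCompact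
  let θ : ∀ i : ι, U →* U' i := fun i => (π i).subgroupMap U
  have hθc : ∀ i, Continuous (θ i) := fun i =>
    continuous_induced_rng.2 ((hπc i).comp continuous_subtype_val)
  have hθs : ∀ i, Function.Surjective (θ i) := fun i => (π i).subgroupMap_surjective U
  -- lifts `ρ₀′` of the Galois action on `μ_p` to `G_{K,S′}` (`N_{S′}` fixes `μ_p`, `S′ ⊇ S_p`)
  have hlift : ∀ i : ι, ∃ ρ₀' : ContinuousRep (GaloisGroupUnramifiedOutside K i.1) ℤ (MuCarrier K p),
      ∀ (σ : absoluteGaloisGroup K) (v : MuCarrier K p),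
        ρ₀' (toUnramifiedQuot K i.1 σ) v = mu K p σ v := fun i => by
    obtain ⟨ρ₀', hρ₀', -⟩ := exists_continuousRep_galoisGroupAbove_mu i.1
      (⊤ : Subgroup (absoluteGaloisGroup K)) (N := p) (fun m hm v => by
        apply MuCarrier.toAdditive.injective
        rw [mu_apply_apply]
        apply congrArg Additive.ofMul
        apply Subtype.ext
        rw [absoluteGaloisGroup.coe_smul_rootsOfUnity]
        exact Units.ext (smul_units_eq_self_of_mem_ramificationSubgroup (N := p) i.2.2.2 _
          ((mem_rootsOfUnity _ _).1 (MuCarrier.toAdditive v).toMul.2) m hm))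
    exact ⟨ρ₀', hρ₀'⟩
  choose ρ₀' hρ₀' using hlift
  have hfix' : ∀ (i : ι), ∀ g ∈ U' i, ∀ v : MuCarrier K p, ρ₀' i g v = v := by
    rintro i _ ⟨u, hu, rfl⟩ v
    obtain ⟨σ, rfl⟩ := toUnramifiedQuot_surjective K S u
    rw [quotientMapOfSubset_mk i.2.1, hρ₀', ← hρ₀]
    exact hfix _ hu v
  -- the descent theorem
  refine subsingleton_continuousCohomology_trivial_of_cofinal_surjections (k := ℤ)
    (ρ₀.restrict (subgroupIncl U)) (fun g a => hfix g.1 g.2 a) (Γ' := fun i => ↥(U' i))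
    (fun i => (ρ₀' i).restrict (subgroupIncl (U' i))) (fun i g a => hfix' i g.1 g.2 a)
    θ hθc hθs (fun V => ?_) n
    (fun i => h i.1 p i.2.2.1 i.2.2.2 hreal (ρ₀' i) (hρ₀' i) (U' i) (hU'o i) (hfix' i))
  -- COFINALITY: `ker θ_{S′} ≤ V` for a suitable finite `S′`
  -- the preimage `Ṽ ≤ Γ_K` of `V` (open, contains `N_S`)
  let Vt : Subgroup (absoluteGaloisGroup K) :=
    (((V : Subgroup U).map U.subtype).comap (toUnramifiedQuot K S))
  have hVto : IsOpen (Vt : Set (absoluteGaloisGroup K)) := by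
    change IsOpen ((toUnramifiedQuot K S) ⁻¹'
      (((V : Subgroup U).map U.subtype : Subgroup (GaloisGroupUnramifiedOutside K S)) :
        Set (GaloisGroupUnramifiedOutside K S)))
    refine IsOpen.preimage (continuous_toUnramifiedQuot K S) ?_
    rw [Subgroup.coe_map]
    exact hU.isOpenMap_subtype_val _ V.isOpen
  have hmemVt : ∀ σ : absoluteGaloisGroup K, σ ∈ Vt ↔
      ∃ hσ : toUnramifiedQuot K S σ ∈ U, (⟨toUnramifiedQuot K S σ, hσ⟩ : U) ∈ (V : Subgroup U) := by
    intro σ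
    rw [Subgroup.mem_comap, Subgroup.mem_map]
    constructor
    · rintro ⟨x, hx, hxσ⟩
      have hxU : toUnramifiedQuot K S σ ∈ U := by
        rw [← hxσ]
        exact x.2
      refine ⟨hxU, ?_⟩
      have hx' : (⟨toUnramifiedQuot K S σ, hxU⟩ : U) = x := Subtype.ext hxσ.symm
      rw [hx']
      exact hx
    · rintro ⟨hσ, hV⟩
      exact ⟨_, hV, rfl⟩
  have hNS : ramificationSubgroup K S ≤ Vt := fun σ hσ => by
    rw [hmemVt]
    have h1 : toUnramifiedQuot K S σ = 1 := (QuotientGroup.eq_one_iff σ).2 hσ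
    have h1U : toUnramifiedQuot K S σ ∈ U := by
      rw [h1]
      exact U.one_mem
    refine ⟨h1U, ?_⟩
    have h1' : (⟨toUnramifiedQuot K S σ, h1U⟩ : U) = 1 := Subtype.ext h1
    rw [h1']
    exact (V : Subgroup U).one_mem
  obtain ⟨S', hS'S, hS'f, hS'p, hNS'⟩ := exists_finite_ramificationSubgroup_le S p hSp Vt hVto hNS
  refine ⟨⟨S', hS'S, hS'f, hS'p⟩, fun u hu => ?_⟩
  -- `u ∈ ker θ_{S′}`: `u = σ N_S` with `σ ∈ N_{S′} ≤ Ṽ`, hence `u ∈ V`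
  rw [MonoidHom.mem_ker] at hu
  have hu' : π ⟨S', hS'S, hS'f, hS'p⟩ (u : GaloisGroupUnramifiedOutside K S) = 1 :=
    congrArg Subtype.val hu
  obtain ⟨σ, hσ⟩ := toUnramifiedQuot_surjective K S (u : GaloisGroupUnramifiedOutside K S)
  rw [← hσ] at hu'
  -- `hu'` : `σ N_{S′} = 1`
  have hσN : σ ∈ ramificationSubgroup K S' := (QuotientGroup.eq_one_iff σ).1 hu'
  obtain ⟨hσU, hσV⟩ := (hmemVt σ).1 (hNS' hσN)
  have hu'' : u = ⟨toUnramifiedQuot K S σ, hσU⟩ := Subtype.ext hσ.symm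
  rw [hu'']
  exact hσV

end Literature.NumberTheory.GaloisCohomology

end
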